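/-
Copyright (c) 2026 the pub-hodgecm-mathlib formalisation cell (harness21).  Prover seat hodgecm-mathlib-K2E1-p09 (g5), Track B ∕ K2-LIT,
h413 = `stmt-HodgeConjecture-24833`, line `K2_E1_TraceFormulaBeta`, campaign «EIS-RANK-ONE»; deal «MS-PAIR-2» (ii) «MS-FIN-2»_two of the dealer K2E1-plan (g4) 2026-09-04T06:39:24Z ∕
06:58:54Z (3): the `U(J₂)` twin, LINE BY LINE, of ★ p857970 + ★ p858059 `K2E1MaassSelbergCMThreePairings` (K2E4-p14) — `2ρ_H = 1`.
-/
import Summits.HodgeConjecture.HodgeConjecture.Theorems.K2E1IntertwiningGrowthU2          -- ★ p857923 (K2E4-p14 g5): [D8]_two `∫ H(w₀vg)^σ dν = c(σ)·H(g)^{1−σ}`, its integrability, `maassSelberg_flatSectionU_two_fin`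
import Summits.HodgeConjecture.HodgeConjecture.Theorems.K2E1MaassSelbergBracketsTwo        -- ★ p857659 (K2E3-p12): (C1)_two `norm_inv_mul_indicator_ofReal_rpow`; imports ★ (δ)_two p857611, ★ BracketsThree `setOf_ideleNorm_mem_Iic_eq`
import Summits.HodgeConjecture.HodgeConjecture.Theorems.K2E1BorelParabolicIntegralU3       -- ★ p857490: Tate below the cut-off `setLIntegral_indicator_ideleNorm_rpow_eq` (idele level, every number field)
import Summits.HodgeConjecture.HodgeConjecture.Theorems.K2E1TorusHeightMellin              -- ★ p857517: Tate above the cut-off `setLIntegral_indicator_lt_rpow_neg`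
import HarnessLib

/-!
# K2·E1 — `K2E1MaassSelbergCMTwoPairings`: HEIGHT-ONLY MAJORANTS AND POINTWISE BOUNDS FOR THE FOUR ABSOLUTE-CONVERGENCE INPUTS `hψL1`, `hi₅`, `habs`, `habs′` OF `U(J₂)`
# (campaign «EIS-RANK-ONE», «MS-PAIR-2» (ii) «MS-FIN-2»_two: the `[0,∞]` Tonelli half of ★ (δ)_two p857611 at height-only weights, Tate at the cut-off, `2ρ_H = 1`)

Track B ∕ K2-LIT, crux h413 = `stmt-HodgeConjecture-24833`, route of record `HCCMUnconditional`; cell `hodgecm-mathlib`, squad K2, ENGINE E1.  Prover seat `hodgecm-mathlib-K2E1-p09` (g5);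
dealt by K2E1-plan (g4) 06:39:24Z («MS-PAIR-2» (ii)) and 06:58:54Z (3) («re-prove at N = 2 following K2E4-p14's lemmas line by line»).  THEOREMS ONLY (no `def`, no `instance`, no
notation, no named-fact hypothesis, no `sorry`); lane `--supports stmt-HodgeConjecture-24833 --as helper` (count-neutral).  Closes no socket.  Generic quadratic `(F, E, c)`, `c² = 1`, `c ≠ 1`
(no `[E:F] = 2` hypothesis is needed at `N = 2`).  The NAMES are those of the `N = 3` file ★ `K2E1MaassSelbergCMThreePairings` in the namespace `…K2E1MaassSelbergCMTwoPairings`.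

THE MATHEMATICS [MoeglinWaldspurger1995, II.1.5, IV.2.1–IV.2.3; Garrett2018, §11.3].  On `U(J₂)` the modulus of the Borel is `δ_B(t) = ‖d₀ t‖` (`2ρ_H = 1`), so the idele weight of
★ (δ)_two is `‖x‖⁻¹` and every exponent of the `N = 3` story drops by one: each of the four surviving absolute-convergence inputs of ★ «CM-FINAL-2» p858104 ∕ ★ [D8]_two p857923
(`hψL1`, `hi₅`, `habs`, `habs′`) is dominated, on the sub-tube `1 < Re z′ < Re z`, by `B(F)`-weighted integrals of HEIGHT-ONLY weights `𝟙_P(H)·H^σ` with the exponent table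
`hψL1 ↦ (Re z; ≤), (1−Re z; >)`, `hi₅, habs ↦ (1+Re z−Re z′; ≤), (2−Re z−Re z′; >)`, `habs′ ↦ (1+Re z′−Re z; >)` (checked against ★ [D8]_two's `‖(M f_z)(g)·H(g)^{z−1}‖ ≤ C_φ·c(Re z)`).
§1 **`exists_lintegral_weight_mul_indicator_borelHeight_rpow_eq_two`** — one `K′ < ∞` with `∫⁻ β·𝟙_P(H)·H^σ dν_G = K′·∫⁻_{𝓕_I} ‖x‖⁻¹·𝟙_P(‖x‖)·‖x‖^σ dν_I` for every covering weight
`β`, Borel `P`, real `σ` (★ (δ)_two's `[0,∞]` half at the left-`N(𝔸)`∕`B(F)`-, right-`K_U`-invariant weight `𝟙_P(H)·H^σ`, `K′ = K·μ_K(K_U)`); the idele integrand is `𝟙_{‖x‖∈P}·‖x‖^{σ−1}`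
(`norm_inv_mul_indicator_rpow_apply`, ★ (C1)_two); finiteness **`lintegral_weight_mul_indicator_le_rpow_lt_top`** (`P = {≤ T}`, `σ > 1`, Tate ★) and
**`lintegral_weight_mul_indicator_lt_rpow_lt_top`** (`P = {> T}`, `σ < 1`, `T > 0`, mirror ★).
§2 pointwise: `ψ = 𝟙_{H≤T}·f_z − 𝟙_{H>T}·(α_t·H^{1−z})`, `χ = 𝟙_{H>T}·(f′_{z′} + α_t′·H^{1−z′})` for ANY bounded `α_t`, `α_t′` (at `α_t = φ̃ := (M(w₀) f_z)·H^{z−1}` these are ★ [D8]_two's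
`ψ`, `χ`, `‖φ̃‖ ≤ C_φ·c(Re z)` ★ [D8]_two §5): **`enorm_psi_le`**, **`enorm_chi_le`** (★ ED. 4 (N = 2) cut-off domination, `1 ≤ 2Re z′`), **`measurable_integral_weylLongU_mul`**,
**`lintegral_enorm_chi_weylLongU_mul_le`** (`≤ (C_φ′ + C_t′·T^{1−2Re z′})·c(Re z′)·H(g)^{1−Re z′}`), **`lintegral_enorm_psi_weylLongU_inv_mul_le`** (`≤ C_φ·c(Re z)·H(g)^{1−Re z}` on `{H(g) > T}`).
HONEST LABEL: HC_CM is proved only modulo the 7 printed citations (2 remaining named inputs: hLiu418 = `stmt-HodgeConjecture-24832`, h413 = `stmt-HodgeConjecture-24833`) until rung 0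
closes; this file asserts no named fact and closes no socket.
References: [MoeglinWaldspurger1995] II.1.5–II.1.7, IV.2.1–IV.2.3 · [Arthur1980TraceFormulaII] §4 · [Garrett2018] §2.8, §11.3 · [Rogawski1990] §2.2, §7.3.
-/

set_option autoImplicit false
-- the mandated namespace repeats the single-problem summit's segment (`HodgeConjecture.HodgeConjecture`)
set_option linter.dupNamespace false

noncomputable section

open MeasureTheory Measure NumberField IsDedekindDomain Set MulAction Filter
open scoped ENNReal NNReal ComplexConjugate
open Literature.MeasureTheory.Group Literature.NumberTheory
open Literature.NumberTheory.Automorphic Literature.NumberTheory.Automorphic.UnitaryGroup AdelicGroupData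
open Summit.HodgeConjecture.HodgeConjecture.Cruxes.H413.K2E1BorelEisensteinU
open Summit.HodgeConjecture.HodgeConjecture.Cruxes.H413.K2E1IdeleClassMellinWeighted
open Summit.HodgeConjecture.HodgeConjecture.Cruxes.H413.K2E1TorusHeightMellin
open Summit.HodgeConjecture.HodgeConjecture.Cruxes.H413.K2E1MaassSelbergBracketsThree
open Summit.HodgeConjecture.HodgeConjecture.Cruxes.H413.K2E1MaassSelbergBracketsTwo (norm_inv_mul_indicator_ofReal_rpow)
open Summit.HodgeConjecture.HodgeConjecture.Cruxes.H413.K2E1BorelParabolicIntegralU2 (borelHeight_coe_eq_ideleNorm_diagUnit)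
open Summit.HodgeConjecture.HodgeConjecture.Cruxes.H413.K2E1EisensteinPairingUnfoldedWeightU2
open Summit.HodgeConjecture.HodgeConjecture.Cruxes.H413.K2E1IntertwiningGrowthU2

namespace Summit.HodgeConjecture.HodgeConjecture.Cruxes.H413.K2E1MaassSelbergCMTwoPairings

variable {F E : Type} [Field F] [NumberField F] [Field E] [NumberField E] [Algebra F E] {c : E ≃ₐ[F] E}
variable [MeasurableSpace (quasiSplit F E c 2).Adelic] [BorelSpace (quasiSplit F E c 2).Adelic]
variable [MeasurableSpace (AdeleRing (𝓞 E) E)ˣ] [BorelSpace (AdeleRing (𝓞 E) E)ˣ]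

/-! ## §1 Height-only majorants: `∫⁻ β·𝟙_P(H)·H^σ dν_G = K′·∫⁻_{𝓕_I} (‖x‖)⁻¹·𝟙_P(‖x‖)·‖x‖^σ dν_I`, finite at the two cut-offs -/

/-- **THE `[0,∞]` TONELLI IDENTITY FOR HEIGHT-ONLY WEIGHTS**: one `K′ < ∞` with `∫⁻ β(g)·𝟙_P(H g)·H(g)^σ dν_G = K′·∫⁻_{𝓕_I} (‖x‖)⁻¹·𝟙_P(‖x‖)·‖x‖^σ dν_I` for every covering weight `β`,
Borel `P`, real `σ` — ★ (δ)_two p857611's `[0,∞]` half at `Ψ = 𝟙_P(H)·H^σ` (left-`N(𝔸)`∕`B(F)`-invariant, `K_U`-invariant: its `K_U`-integral along the torus is `μ_K(K_U)·𝟙_P(‖d₀t‖)·‖d₀t‖^σ`;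
`K′ = K·μ_K(K_U)`, `K_U` compact ★). [cite: MoeglinWaldspurger1995, II.1.5] [cite: Garrett2018, §11.3] -/
theorem exists_lintegral_weight_mul_indicator_borelHeight_rpow_eq_two (hc : c * c = 1) (hc1 : c ≠ 1)
    (νG : Measure (quasiSplit F E c 2).Adelic) [νG.IsHaarMeasure]
    (μK : Measure ((standardMaximalCompactGL 2 E).comap (adelicVal F E c 2 ((StdForm.antidiagonal 2).over E)) : Subgroup (quasiSplit F E c 2).Adelic))
    [μK.IsHaarMeasure]
    (νI : Measure (AdeleRing (𝓞 E) E)ˣ) [νI.IsHaarMeasure]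
    (hBK : ∀ g : (quasiSplit F E c 2).Adelic, ∃ b ∈ borelAdelic F E c 2, ∃ k : (quasiSplit F E c 2).Adelic,
      adelicVal F E c 2 ((StdForm.antidiagonal 2).over E) k ∈ standardMaximalCompactGL 2 E ∧ g = b * k)
    {𝓕 : Set (AdeleRing (𝓞 E) E)ˣ} (h𝓕 : IsIdeleClassDomain E 𝓕) :
    ∃ K' : ℝ≥0∞, K' ≠ ∞ ∧
      ∀ β : (quasiSplit F E c 2).Adelic → ℝ≥0∞, IsCoveringWeight ((arithmeticBorel F E c 2).map (quasiSplit F E c 2).arithmeticSubgroup.subtype) β →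
      ∀ P : Set ℝ≥0, MeasurableSet P → ∀ σ : ℝ,
        ∫⁻ g, β g * P.indicator (fun h : ℝ≥0 => ENNReal.ofReal ((h : ℝ) ^ σ)) (borelHeight g) ∂νG =
          K' * ∫⁻ x in 𝓕, (((IdeleClassGroup.ideleNorm E x)⁻¹ : ℝ≥0) : ℝ≥0∞) *
            P.indicator (fun h : ℝ≥0 => ENNReal.ofReal ((h : ℝ) ^ σ)) (IdeleClassGroup.ideleNorm E x) ∂νI := by
  obtain ⟨K, -, hKt, hδ, -⟩ := exists_integral_weight_smul_eq_mul_setIntegral_ideleClass_two hc hc1 νG μK νI hBK h𝓕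
  have hKc : IsCompact (((standardMaximalCompactGL 2 E).comap (adelicVal F E c 2 ((StdForm.antidiagonal 2).over E)) :
      Subgroup (quasiSplit F E c 2).Adelic) : Set (quasiSplit F E c 2).Adelic) := isCompact_comap_adelicVal_standardMaximalCompactGL
  haveI : CompactSpace ((standardMaximalCompactGL 2 E).comap (adelicVal F E c 2 ((StdForm.antidiagonal 2).over E)) : Subgroup (quasiSplit F E c 2).Adelic) :=
    isCompact_iff_compactSpace.1 hKc
  haveI : IsFiniteMeasure μK := CompactSpace.isFiniteMeasure
  refine ⟨K * μK Set.univ, ENNReal.mul_ne_top hKt (measure_ne_top μK _), fun β hβ P hP σ => ?_⟩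
  have hIm : Measurable fun x : (AdeleRing (𝓞 E) E)ˣ => IdeleClassGroup.ideleNorm E x := (continuous_ideleNorm_holds E).measurable
  have hwm : Measurable (P.indicator (fun h : ℝ≥0 => ENNReal.ofReal ((h : ℝ) ^ σ))) :=
    (ENNReal.measurable_ofReal.comp (measurable_coe_nnreal_real.pow_const σ)).indicator hP
  -- the height-only weight, its invariances and its `K_U`-integral along the torus
  have hΨN : ∀ (n : unipotentInBorel F E c 2) (y : (quasiSplit F E c 2).Adelic),
      P.indicator (fun h : ℝ≥0 => ENNReal.ofReal ((h : ℝ) ^ σ)) (borelHeight (((n : borelAdelic F E c 2) : (quasiSplit F E c 2).Adelic) * y)) =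
        P.indicator (fun h : ℝ≥0 => ENNReal.ofReal ((h : ℝ) ^ σ)) (borelHeight y) := fun n y => by
    rw [borelHeight_unipotent_mul ((mem_unipotentInBorel_iff _).1 n.2)]
  have hΨB : ∀ b ∈ arithmeticBorel F E c 2, ∀ y : (quasiSplit F E c 2).Adelic,
      P.indicator (fun h : ℝ≥0 => ENNReal.ofReal ((h : ℝ) ^ σ)) (borelHeight ((b : (quasiSplit F E c 2).Adelic) * y)) =
        P.indicator (fun h : ℝ≥0 => ENNReal.ofReal ((h : ℝ) ^ σ)) (borelHeight y) := fun b hb y => by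
    rw [K2E1TruncatedEisensteinExplicit.borelHeight_arithmeticBorel_mul hb]
  have hΦK : ∀ k ∈ GaloisRepresentations.principalIdeles E, ∀ x : (AdeleRing (𝓞 E) E)ˣ,
      P.indicator (fun h : ℝ≥0 => ENNReal.ofReal ((h : ℝ) ^ σ)) (IdeleClassGroup.ideleNorm E (k * x)) * μK Set.univ =
        P.indicator (fun h : ℝ≥0 => ENNReal.ofReal ((h : ℝ) ^ σ)) (IdeleClassGroup.ideleNorm E x) * μK Set.univ := fun k hk x => by
    rw [map_mul, ideleNorm_principal hk, one_mul]
  have hAvg : ∀ t : torusInBorel F E c 2,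
      ∫⁻ k, P.indicator (fun h : ℝ≥0 => ENNReal.ofReal ((h : ℝ) ^ σ))
          (borelHeight (((t : borelAdelic F E c 2) : (quasiSplit F E c 2).Adelic) * (k : (quasiSplit F E c 2).Adelic))) ∂μK =
        P.indicator (fun h : ℝ≥0 => ENNReal.ofReal ((h : ℝ) ^ σ)) (IdeleClassGroup.ideleNorm E (diagUnit (t : borelAdelic F E c 2).2 0)) * μK Set.univ := fun t => by
    simp_rw [borelHeight_mul_of_mem_comap_standardMaximalCompactGL (Subtype.prop _), borelHeight_coe_eq_ideleNorm_diagUnit]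
    rw [lintegral_const]
  have h := hδ β hβ (fun y => P.indicator (fun h : ℝ≥0 => ENNReal.ofReal ((h : ℝ) ^ σ)) (borelHeight y)) (hwm.comp measurable_borelHeight) hΨN hΨB
    (fun x => P.indicator (fun h : ℝ≥0 => ENNReal.ofReal ((h : ℝ) ^ σ)) (IdeleClassGroup.ideleNorm E x) * μK Set.univ) ((hwm.comp hIm).mul_const _) hΦK hAvg
  rw [h, mul_assoc, ← lintegral_const_mul' _ _ (measure_ne_top μK _)]
  congr 1
  refine lintegral_congr fun x => ?_
  ring


omit [MeasurableSpace (quasiSplit F E c 2).Adelic] [BorelSpace (quasiSplit F E c 2).Adelic] [MeasurableSpace (AdeleRing (𝓞 E) E)ˣ] [BorelSpace (AdeleRing (𝓞 E) E)ˣ] in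
/-- The `δ_B⁻¹`-weighted idele integrand of a height-only weight: `(‖x‖)⁻¹ · 𝟙_P(‖x‖)·‖x‖^σ = 𝟙_{‖x‖ ∈ P}·‖x‖^{σ−1}` (★ (C1)_two `norm_inv_mul_indicator_ofReal_rpow` at `C = 1`). [folklore] -/
theorem norm_inv_mul_indicator_rpow_apply (P : Set ℝ≥0) (σ : ℝ) (x : (AdeleRing (𝓞 E) E)ˣ) :
    (((IdeleClassGroup.ideleNorm E x)⁻¹ : ℝ≥0) : ℝ≥0∞) * P.indicator (fun h : ℝ≥0 => ENNReal.ofReal ((h : ℝ) ^ σ)) (IdeleClassGroup.ideleNorm E x) =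
      {x : (AdeleRing (𝓞 E) E)ˣ | IdeleClassGroup.ideleNorm E x ∈ P}.indicator (fun x => ENNReal.ofReal ((IdeleClassGroup.ideleNorm E x : ℝ) ^ (σ - 1))) x := by
  have h : P.indicator (fun h : ℝ≥0 => ENNReal.ofReal ((h : ℝ) ^ σ)) (IdeleClassGroup.ideleNorm E x) =
      {x : (AdeleRing (𝓞 E) E)ˣ | IdeleClassGroup.ideleNorm E x ∈ P}.indicator (fun x => ENNReal.ofReal ((IdeleClassGroup.ideleNorm E x : ℝ) ^ σ * 1)) x := by
    by_cases hx : IdeleClassGroup.ideleNorm E x ∈ P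
    · rw [Set.indicator_of_mem hx, Set.indicator_of_mem (show x ∈ {x : (AdeleRing (𝓞 E) E)ˣ | IdeleClassGroup.ideleNorm E x ∈ P} from hx), mul_one]
    · rw [Set.indicator_of_notMem hx, Set.indicator_of_notMem (show x ∉ {x : (AdeleRing (𝓞 E) E)ˣ | IdeleClassGroup.ideleNorm E x ∈ P} from hx)]
  rw [h, norm_inv_mul_indicator_ofReal_rpow P σ zero_le_one x, ENNReal.ofReal_one, one_mul]

/-- **FINITE BELOW THE CUT-OFF** (`σ > 1`): `∫⁻ β·𝟙_{H ≤ T}·H^σ dν_G < ∞` — §1's identity and Tate at the cut-off ★ `setLIntegral_indicator_ideleNorm_rpow_eq` (exponent `σ − 1 > 0`).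
[cite: MoeglinWaldspurger1995, II.1.5] -/
theorem lintegral_weight_mul_indicator_le_rpow_lt_top (hc : c * c = 1) (hc1 : c ≠ 1)
    (νG : Measure (quasiSplit F E c 2).Adelic) [νG.IsHaarMeasure]
    (μK : Measure ((standardMaximalCompactGL 2 E).comap (adelicVal F E c 2 ((StdForm.antidiagonal 2).over E)) : Subgroup (quasiSplit F E c 2).Adelic))
    [μK.IsHaarMeasure]
    (νI : Measure (AdeleRing (𝓞 E) E)ˣ) [νI.IsHaarMeasure]
    (hBK : ∀ g : (quasiSplit F E c 2).Adelic, ∃ b ∈ borelAdelic F E c 2, ∃ k : (quasiSplit F E c 2).Adelic,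
      adelicVal F E c 2 ((StdForm.antidiagonal 2).over E) k ∈ standardMaximalCompactGL 2 E ∧ g = b * k)
    {𝓕I : Set (AdeleRing (𝓞 E) E)ˣ} (h𝓕I : IsIdeleClassDomain E 𝓕I)
    {β : (quasiSplit F E c 2).Adelic → ℝ≥0∞} (hβ : IsCoveringWeight ((arithmeticBorel F E c 2).map (quasiSplit F E c 2).arithmeticSubgroup.subtype) β)
    {σ : ℝ} (hσ : 1 < σ) (T : ℝ≥0) :
    ∫⁻ g, β g * (Set.Iic T).indicator (fun h : ℝ≥0 => ENNReal.ofReal ((h : ℝ) ^ σ)) (borelHeight g) ∂νG < ∞ := by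
  obtain ⟨K', hK', hId⟩ := exists_lintegral_weight_mul_indicator_borelHeight_rpow_eq_two hc hc1 νG μK νI hBK h𝓕I
  rw [hId β hβ _ measurableSet_Iic σ]
  simp_rw [norm_inv_mul_indicator_rpow_apply]
  rw [show {x : (AdeleRing (𝓞 E) E)ˣ | IdeleClassGroup.ideleNorm E x ∈ Set.Iic T} = {x : (AdeleRing (𝓞 E) E)ˣ | IdeleClassGroup.ideleNorm E x ≤ T} from rfl,
    K2E1BorelParabolicIntegralU3.setLIntegral_indicator_ideleNorm_rpow_eq E νI h𝓕I (by linarith) T]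
  exact ENNReal.mul_lt_top hK'.lt_top (ENNReal.mul_lt_top (idelicCovolume_lt_top νI) ENNReal.ofReal_lt_top)

/-- **FINITE ABOVE THE CUT-OFF** (`σ < 1`, `0 < T`): `∫⁻ β·𝟙_{T < H}·H^σ dν_G < ∞` — §1's identity and the mirror ★ `setLIntegral_indicator_lt_rpow_neg` (exponent `σ − 1 < 0`).
[cite: MoeglinWaldspurger1995, II.1.5] -/
theorem lintegral_weight_mul_indicator_lt_rpow_lt_top (hc : c * c = 1) (hc1 : c ≠ 1)
    (νG : Measure (quasiSplit F E c 2).Adelic) [νG.IsHaarMeasure]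
    (μK : Measure ((standardMaximalCompactGL 2 E).comap (adelicVal F E c 2 ((StdForm.antidiagonal 2).over E)) : Subgroup (quasiSplit F E c 2).Adelic))
    [μK.IsHaarMeasure]
    (νI : Measure (AdeleRing (𝓞 E) E)ˣ) [νI.IsHaarMeasure]
    (hBK : ∀ g : (quasiSplit F E c 2).Adelic, ∃ b ∈ borelAdelic F E c 2, ∃ k : (quasiSplit F E c 2).Adelic,
      adelicVal F E c 2 ((StdForm.antidiagonal 2).over E) k ∈ standardMaximalCompactGL 2 E ∧ g = b * k)
    {𝓕I : Set (AdeleRing (𝓞 E) E)ˣ} (h𝓕I : IsIdeleClassDomain E 𝓕I)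
    {β : (quasiSplit F E c 2).Adelic → ℝ≥0∞} (hβ : IsCoveringWeight ((arithmeticBorel F E c 2).map (quasiSplit F E c 2).arithmeticSubgroup.subtype) β)
    {σ : ℝ} (hσ : σ < 1) {T : ℝ≥0} (hT : 0 < T) :
    ∫⁻ g, β g * (Set.Ioi T).indicator (fun h : ℝ≥0 => ENNReal.ofReal ((h : ℝ) ^ σ)) (borelHeight g) ∂νG < ∞ := by
  obtain ⟨K', hK', hId⟩ := exists_lintegral_weight_mul_indicator_borelHeight_rpow_eq_two hc hc1 νG μK νI hBK h𝓕I
  rw [hId β hβ _ measurableSet_Ioi σ]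
  simp_rw [norm_inv_mul_indicator_rpow_apply]
  rw [(setOf_ideleNorm_mem_Iic_eq (E := E) T).2, show σ - 1 = -(1 - σ) by ring,
    setLIntegral_indicator_lt_rpow_neg νI (h𝓕I.isFundamentalDomain νI) (by linarith) (NNReal.coe_pos.2 hT)]
  exact ENNReal.mul_lt_top hK'.lt_top (ENNReal.mul_lt_top (idelicCovolume_lt_top νI) ENNReal.ofReal_lt_top)

/-! ## §2 (ED. 2) Pointwise: `|ψ|`, `∫_u |χ(w₀ u g)| dν`, `∫_u |ψ(w₀⁻¹ u g)| dν` are dominated by height-only weights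
(ED. 2 of the dealer K2E1-plan (g4) 2026-09-04T06:36:29Z (6), prover seat `hodgecm-mathlib-K2E4-p14` (g6); `ψ = 𝟙_{H≤T}·f_z − 𝟙_{H>T}·(α_t·H^{1−z})` and
`χ = 𝟙_{H>T}·(f′_{z′} + α_t′·H^{1−z′})` for ANY bounded coefficients `α_t`, `α_t′` — at `α_t = φ̃ := (M(w₀) f_z)·H^{z−1}` these are ★ [D8]_two's `ψ`, `χ`, and `‖φ̃‖ ≤ C_φ·c(Re z)` is ★ [D8]_two §5) -/

section Pointwise

open Summit.HodgeConjecture.HodgeConjecture.Cruxes.H413.K2E1MaassSelbergCMTwoConstantTerms (norm_indicator_lt_add_flatSectionU_le_two measurable_intertwinedCoeff_two)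
open Summit.HodgeConjecture.HodgeConjecture.Cruxes.H413.K2E1BorelHeightWeylUnipotent (not_lt_borelHeight_weylLongU_unipotent_mul)
open Summit.HodgeConjecture.HodgeConjecture.Cruxes.H413.K2E1IntertwiningAdjoint (weylLongU_mul_weylLongU_two)

omit [MeasurableSpace (quasiSplit F E c 2).Adelic] [BorelSpace (quasiSplit F E c 2).Adelic] [MeasurableSpace (AdeleRing (𝓞 E) E)ˣ] [BorelSpace (AdeleRing (𝓞 E) E)ˣ] in
/-- Height powers merge under a cut-off, in `[0,∞]`: `H(g)^a · (𝟙_P(H g)·H(g)^b) = 𝟙_P(H g)·H(g)^{a+b}` (`H(g) > 0` ★ `borelHeight_pos`). [folklore] -/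
theorem ofReal_rpow_mul_indicator_rpow_borelHeight (P : Set ℝ≥0) (a b : ℝ) (g : (quasiSplit F E c 2).Adelic) :
    ENNReal.ofReal ((borelHeight g : ℝ) ^ a) * P.indicator (fun h : ℝ≥0 => ENNReal.ofReal ((h : ℝ) ^ b)) (borelHeight g) =
      P.indicator (fun h : ℝ≥0 => ENNReal.ofReal ((h : ℝ) ^ (a + b))) (borelHeight g) := by
  have hpos : (0 : ℝ) < (borelHeight g : ℝ) := by exact_mod_cast borelHeight_pos g
  by_cases hP : borelHeight g ∈ P
  · rw [indicator_of_mem hP, indicator_of_mem hP, ← ENNReal.ofReal_mul (Real.rpow_nonneg hpos.le _), Real.rpow_add hpos]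
  · rw [indicator_of_notMem hP, indicator_of_notMem hP, mul_zero]

omit [MeasurableSpace (quasiSplit F E c 2).Adelic] [BorelSpace (quasiSplit F E c 2).Adelic] [MeasurableSpace (AdeleRing (𝓞 E) E)ˣ] [BorelSpace (AdeleRing (𝓞 E) E)ˣ] in
/-- **`|ψ(g)| ≤ C_φ·𝟙_{H≤T}(g)·H(g)^{Re z} + C_t·𝟙_{H>T}(g)·H(g)^{2−Re z}`** for `ψ = 𝟙_{H≤T}·f_z − 𝟙_{H>T}·(α_t·H^{1−z})`, `‖φ‖ ≤ C_φ`, `‖α_t‖ ≤ C_t` (at `α_t = φ̃`: `C_t = C_φ·c(Re z)`,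
★ [D8]_two `norm_intertwinedCoeff_le`). [cite: MoeglinWaldspurger1995, II.1.5] -/
theorem enorm_psi_le {φ αt : (quasiSplit F E c 2).Adelic → ℂ} {Cφ Ct : ℝ} (hφC : ∀ x, ‖φ x‖ ≤ Cφ) (hCt : ∀ x, ‖αt x‖ ≤ Ct) (z : ℂ) (T : ℝ≥0) (g : (quasiSplit F E c 2).Adelic) :
    ‖{y : (quasiSplit F E c 2).Adelic | borelHeight y ≤ T}.indicator (flatSectionU φ z) g - {y : (quasiSplit F E c 2).Adelic | T < borelHeight y}.indicator (flatSectionU αt (1 - z)) g‖ₑ ≤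
      ENNReal.ofReal Cφ * (Set.Iic T).indicator (fun h : ℝ≥0 => ENNReal.ofReal ((h : ℝ) ^ z.re)) (borelHeight g) +
        ENNReal.ofReal Ct * (Set.Ioi T).indicator (fun h : ℝ≥0 => ENNReal.ofReal ((h : ℝ) ^ (1 - z.re))) (borelHeight g) := by
  have hpos : (0 : ℝ) < (borelHeight g : ℝ) := by exact_mod_cast borelHeight_pos g
  by_cases hg : borelHeight g ≤ T
  · have hng : ¬ T < borelHeight g := not_lt.2 hg
    rw [indicator_of_mem (show g ∈ {y : (quasiSplit F E c 2).Adelic | borelHeight y ≤ T} from hg),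
      indicator_of_notMem (show g ∉ {y : (quasiSplit F E c 2).Adelic | T < borelHeight y} from hng), sub_zero,
      indicator_of_mem (show borelHeight g ∈ Set.Iic T from hg), indicator_of_notMem (show borelHeight g ∉ Set.Ioi T from hng), mul_zero, add_zero,
      ← ofReal_norm, flatSectionU_apply, norm_mul, Complex.norm_cpow_eq_rpow_re_of_pos hpos, ← ENNReal.ofReal_mul ((norm_nonneg _).trans (hφC g))]
    exact ENNReal.ofReal_le_ofReal (mul_le_mul_of_nonneg_right (hφC g) (Real.rpow_nonneg hpos.le _))
  · have hgt : T < borelHeight g := not_le.1 hg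
    rw [indicator_of_notMem (show g ∉ {y : (quasiSplit F E c 2).Adelic | borelHeight y ≤ T} from hg),
      indicator_of_mem (show g ∈ {y : (quasiSplit F E c 2).Adelic | T < borelHeight y} from hgt), zero_sub, enorm_neg,
      indicator_of_notMem (show borelHeight g ∉ Set.Iic T from hg), indicator_of_mem (show borelHeight g ∈ Set.Ioi T from hgt), mul_zero, zero_add,
      ← ofReal_norm, flatSectionU_apply, norm_mul, Complex.norm_cpow_eq_rpow_re_of_pos hpos, Complex.sub_re, Complex.one_re,
      ← ENNReal.ofReal_mul ((norm_nonneg _).trans (hCt g))]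
    exact ENNReal.ofReal_le_ofReal (mul_le_mul_of_nonneg_right (hCt g) (Real.rpow_nonneg hpos.le _))

omit [MeasurableSpace (quasiSplit F E c 2).Adelic] [BorelSpace (quasiSplit F E c 2).Adelic] [MeasurableSpace (AdeleRing (𝓞 E) E)ˣ] [BorelSpace (AdeleRing (𝓞 E) E)ˣ] in
/-- **`|χ(y)| ≤ (C_φ′ + C_t′·T^{1−2Re z′})·H(y)^{Re z′}`** in `[0,∞]` for the cut-off `χ = 𝟙_{H>T}·(f′_{z′} + α_t′·H^{1−z′})` (`0 < T`, `1 ≤ 2Re z′`; ★ ED. 4 (N = 2) `norm_indicator_lt_add_flatSectionU_le_two`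
with `‖1·H^{z′}(y)‖ = H(y)^{Re z′}`). [cite: MoeglinWaldspurger1995, II.1.5] -/
theorem enorm_chi_le {φ' αt' : (quasiSplit F E c 2).Adelic → ℂ} {Cφ' Ct' : ℝ} (hφ'C : ∀ x, ‖φ' x‖ ≤ Cφ') (hCt' : ∀ x, ‖αt' x‖ ≤ Ct') {T : ℝ≥0} (hT0 : 0 < T)
    {z' : ℂ} (hz' : 1 ≤ 2 * z'.re) (y : (quasiSplit F E c 2).Adelic) :
    ‖{y : (quasiSplit F E c 2).Adelic | T < borelHeight y}.indicator (flatSectionU φ' z' + flatSectionU αt' (1 - z')) y‖ₑ ≤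
      ENNReal.ofReal (Cφ' + Ct' * (T : ℝ) ^ (1 - 2 * z'.re)) * ENNReal.ofReal ((borelHeight y : ℝ) ^ z'.re) := by
  have hpos : (0 : ℝ) < (borelHeight y : ℝ) := by exact_mod_cast borelHeight_pos y
  have hA : 0 ≤ Cφ' + Ct' * (T : ℝ) ^ (1 - 2 * z'.re) :=
    add_nonneg ((norm_nonneg _).trans (hφ'C 1)) (mul_nonneg ((norm_nonneg _).trans (hCt' 1)) (Real.rpow_nonneg (NNReal.coe_nonneg T) _))
  have h := norm_indicator_lt_add_flatSectionU_le_two hφ'C hCt' hT0 hz' y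
  rw [flatSectionU_apply, one_mul, Complex.norm_cpow_eq_rpow_re_of_pos hpos] at h
  rw [← ofReal_norm, ← ENNReal.ofReal_mul hA]
  exact ENNReal.ofReal_le_ofReal h

omit [MeasurableSpace (AdeleRing (𝓞 E) E)ˣ] [BorelSpace (AdeleRing (𝓞 E) E)ˣ] in
/-- **`g ↦ ∫_{N(𝔸)} h(w₀ u g) dν(u)` IS BOREL** for Borel `h` (★ ED. 5 (N = 2) `measurable_intertwinedCoeff_two` at the flat section `h·H^0` and the outer factor `H^0`: the parametric Bochner integral of a
jointly Borel integrand, `N(𝔸)` second countable, `ν` s-finite). [cite: MoeglinWaldspurger1995, II.1.6] -/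
theorem measurable_integral_weylLongU_mul (ν : Measure ↥(adelicUnipotent F E c 2)) [ν.IsHaarMeasure] {h : (quasiSplit F E c 2).Adelic → ℂ} (hh : Measurable h) :
    Measurable fun g : (quasiSplit F E c 2).Adelic => ∫ u : ↥(adelicUnipotent F E c 2),
      h ((quasiSplit F E c 2).toAdelic (weylLongU (c : E →+* E) (rfl : (StdForm.antidiagonal 2).over E = (StdForm.antidiagonal 2).over E)) * ((u : (quasiSplit F E c 2).Adelic) * g)) ∂ν := by
  have key := measurable_intertwinedCoeff_two ν hh 0 0
  simp only [flatSectionU_apply, Complex.cpow_zero, mul_one] at key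
  exact key

omit [MeasurableSpace (AdeleRing (𝓞 E) E)ˣ] [BorelSpace (AdeleRing (𝓞 E) E)ˣ] in
/-- **`∫_u ‖χ(w₀ u g)‖ dν(u) ≤ (C_φ′ + C_t′·T^{1−2Re z′}) · c(Re z′) · H(g)^{1−Re z′}`** in `[0,∞]`, `c(σ) = ∫_{N(𝔸)} H(w₀ v)^σ dν`: pointwise `|χ| ≤ (…)·H^{Re z′}` (`enorm_chi_le`), the
integrability of `u ↦ H(w₀ u g)^{Re z′}` from the Godement finiteness of `H^{z′}` at `g` (★ [D8]_two §4) and the standard intertwining integral ★ [D8]_two §3 `∫ H(w₀ u g)^σ dν = c(σ)·H(g)^{1−σ}`.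
[cite: MoeglinWaldspurger1995, II.1.6] [cite: Garrett2018, §2.8] -/
theorem lintegral_enorm_chi_weylLongU_mul_le (hc : c * c = 1) (hc1 : c ≠ 1) (ν : Measure ↥(adelicUnipotent F E c 2)) [ν.IsHaarMeasure] [ν.IsInvInvariant]
    (hBK : ∀ g : (quasiSplit F E c 2).Adelic, ∃ b ∈ borelAdelic F E c 2, ∃ k : (quasiSplit F E c 2).Adelic, adelicVal F E c 2 ((StdForm.antidiagonal 2).over E) k ∈ standardMaximalCompactGL 2 E ∧ g = b * k)
    {𝓕 : Set ↥(adelicUnipotent F E c 2)} (h𝓕N : IsFundamentalDomain ↥(rationalUnipotent F E c 2) 𝓕 ν)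
    {φ' αt' : (quasiSplit F E c 2).Adelic → ℂ} {Cφ' Ct' : ℝ} (hφ'C : ∀ x, ‖φ' x‖ ≤ Cφ') (hCt' : ∀ x, ‖αt' x‖ ≤ Ct') {T : ℝ≥0} (hT0 : 0 < T) {z' : ℂ} (hz' : 1 ≤ 2 * z'.re)
    (g : (quasiSplit F E c 2).Adelic)
    (hfin : ∫⁻ u in 𝓕, (∑' q : (quasiSplit F E c 2).quotientSubgroup ⧸ (borelAdelic F E c 2).subgroupOf (quasiSplit F E c 2).quotientSubgroup,
        ‖flatSectionU (fun _ : (quasiSplit F E c 2).Adelic => (1 : ℂ)) z' ((((q.out : (quasiSplit F E c 2).quotientSubgroup) : (quasiSplit F E c 2).Adelic))⁻¹ * (u : (quasiSplit F E c 2).Adelic) * g)‖ₑ) ∂ν < ∞) :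
    ∫⁻ u : ↥(adelicUnipotent F E c 2), ‖{y : (quasiSplit F E c 2).Adelic | T < borelHeight y}.indicator (flatSectionU φ' z' + flatSectionU αt' (1 - z'))
        ((quasiSplit F E c 2).toAdelic (weylLongU (c : E →+* E) (rfl : (StdForm.antidiagonal 2).over E = (StdForm.antidiagonal 2).over E)) * ((u : (quasiSplit F E c 2).Adelic) * g))‖ₑ ∂ν ≤
      ENNReal.ofReal (Cφ' + Ct' * (T : ℝ) ^ (1 - 2 * z'.re)) *
        ENNReal.ofReal (∫ v : ↥(adelicUnipotent F E c 2), (borelHeight ((quasiSplit F E c 2).toAdelic (weylLongU (c : E →+* E) (rfl : (StdForm.antidiagonal 2).over E = (StdForm.antidiagonal 2).over E)) * (v : (quasiSplit F E c 2).Adelic)) : ℝ) ^ z'.re ∂ν) *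
          ENNReal.ofReal ((borelHeight g : ℝ) ^ (1 - z'.re)) := by
  have hc0 : 0 ≤ ∫ v : ↥(adelicUnipotent F E c 2), (borelHeight ((quasiSplit F E c 2).toAdelic (weylLongU (c : E →+* E) (rfl : (StdForm.antidiagonal 2).over E = (StdForm.antidiagonal 2).over E)) * (v : (quasiSplit F E c 2).Adelic)) : ℝ) ^ z'.re ∂ν :=
    integral_nonneg fun v => Real.rpow_nonneg (NNReal.coe_nonneg _) _
  have hA : 0 ≤ Cφ' + Ct' * (T : ℝ) ^ (1 - 2 * z'.re) :=
    add_nonneg ((norm_nonneg _).trans (hφ'C 1)) (mul_nonneg ((norm_nonneg _).trans (hCt' 1)) (Real.rpow_nonneg (NNReal.coe_nonneg T) _))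
  have hI := integrable_borelHeight_weylLongU_mul_rpow ν h𝓕N z' g hfin
  calc ∫⁻ u : ↥(adelicUnipotent F E c 2), ‖{y : (quasiSplit F E c 2).Adelic | T < borelHeight y}.indicator (flatSectionU φ' z' + flatSectionU αt' (1 - z'))
          ((quasiSplit F E c 2).toAdelic (weylLongU (c : E →+* E) (rfl : (StdForm.antidiagonal 2).over E = (StdForm.antidiagonal 2).over E)) * ((u : (quasiSplit F E c 2).Adelic) * g))‖ₑ ∂ν
      ≤ ∫⁻ u : ↥(adelicUnipotent F E c 2), ENNReal.ofReal (Cφ' + Ct' * (T : ℝ) ^ (1 - 2 * z'.re)) *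
          ENNReal.ofReal ((borelHeight ((quasiSplit F E c 2).toAdelic (weylLongU (c : E →+* E) (rfl : (StdForm.antidiagonal 2).over E = (StdForm.antidiagonal 2).over E)) * ((u : (quasiSplit F E c 2).Adelic) * g)) : ℝ) ^ z'.re) ∂ν :=
        lintegral_mono fun u => enorm_chi_le hφ'C hCt' hT0 hz' _
    _ = ENNReal.ofReal (Cφ' + Ct' * (T : ℝ) ^ (1 - 2 * z'.re)) *
          ENNReal.ofReal (∫ u : ↥(adelicUnipotent F E c 2), (borelHeight ((quasiSplit F E c 2).toAdelic (weylLongU (c : E →+* E) (rfl : (StdForm.antidiagonal 2).over E = (StdForm.antidiagonal 2).over E)) * ((u : (quasiSplit F E c 2).Adelic) * g)) : ℝ) ^ z'.re ∂ν) := by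
        rw [lintegral_const_mul' _ _ ENNReal.ofReal_ne_top, ofReal_integral_eq_lintegral_ofReal hI (Eventually.of_forall fun u => Real.rpow_nonneg (NNReal.coe_nonneg _) _)]
    _ = _ := by rw [integral_borelHeight_weylLongU_mul_rpow_eq hc hc1 ν hBK z'.re g, ENNReal.ofReal_mul hc0, mul_assoc]

omit [MeasurableSpace (AdeleRing (𝓞 E) E)ˣ] [BorelSpace (AdeleRing (𝓞 E) E)ˣ] in
/-- **`∫_u ‖ψ(w₀⁻¹ u g)‖ dν(u) ≤ C_φ · c(Re z) · H(g)^{2−Re z}` ON `{H(g) > T}`** (`T ≥ 1`): there every `w₀ u g` is low (★ R6a `not_lt_borelHeight_weylLongU_unipotent_mul`, `w₀⁻¹ = w₀` ★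
`weylLongU_mul_weylLongU_two`), so `ψ(w₀⁻¹ u g) = f_z(w₀ u g)`, `|f_z| ≤ C_φ·H^{Re z}`, and ★ [D8]_two §3∕§4 evaluate∕control `∫ H(w₀ u g)^{Re z} dν = c(Re z)·H(g)^{2−Re z}`.
[cite: MoeglinWaldspurger1995, II.1.6–II.1.7] [cite: Garrett2018, §2.8] -/
theorem lintegral_enorm_psi_weylLongU_inv_mul_le (hc : c * c = 1) (hc1 : c ≠ 1) (ν : Measure ↥(adelicUnipotent F E c 2)) [ν.IsHaarMeasure] [ν.IsInvInvariant]
    (hBK : ∀ g : (quasiSplit F E c 2).Adelic, ∃ b ∈ borelAdelic F E c 2, ∃ k : (quasiSplit F E c 2).Adelic, adelicVal F E c 2 ((StdForm.antidiagonal 2).over E) k ∈ standardMaximalCompactGL 2 E ∧ g = b * k)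
    {𝓕 : Set ↥(adelicUnipotent F E c 2)} (h𝓕N : IsFundamentalDomain ↥(rationalUnipotent F E c 2) 𝓕 ν)
    {φ : (quasiSplit F E c 2).Adelic → ℂ} (αt : (quasiSplit F E c 2).Adelic → ℂ) {Cφ : ℝ} (hφC : ∀ x, ‖φ x‖ ≤ Cφ) (z : ℂ) {T : ℝ≥0} (hT : 1 ≤ T)
    {g : (quasiSplit F E c 2).Adelic} (hg : T < borelHeight g)
    (hfin : ∫⁻ u in 𝓕, (∑' q : (quasiSplit F E c 2).quotientSubgroup ⧸ (borelAdelic F E c 2).subgroupOf (quasiSplit F E c 2).quotientSubgroup,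
        ‖flatSectionU (fun _ : (quasiSplit F E c 2).Adelic => (1 : ℂ)) z ((((q.out : (quasiSplit F E c 2).quotientSubgroup) : (quasiSplit F E c 2).Adelic))⁻¹ * (u : (quasiSplit F E c 2).Adelic) * g)‖ₑ) ∂ν < ∞) :
    ∫⁻ u : ↥(adelicUnipotent F E c 2), ‖{y : (quasiSplit F E c 2).Adelic | borelHeight y ≤ T}.indicator (flatSectionU φ z) (((quasiSplit F E c 2).toAdelic (weylLongU (c : E →+* E) (rfl : (StdForm.antidiagonal 2).over E = (StdForm.antidiagonal 2).over E)))⁻¹ * ((u : (quasiSplit F E c 2).Adelic) * g)) - {y : (quasiSplit F E c 2).Adelic | T < borelHeight y}.indicator (flatSectionU αt (1 - z)) (((quasiSplit F E c 2).toAdelic (weylLongU (c : E →+* E) (rfl : (StdForm.antidiagonal 2).over E = (StdForm.antidiagonal 2).over E)))⁻¹ * ((u : (quasiSplit F E c 2).Adelic) * g))‖ₑ ∂ν ≤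
      ENNReal.ofReal Cφ *
        ENNReal.ofReal (∫ v : ↥(adelicUnipotent F E c 2), (borelHeight ((quasiSplit F E c 2).toAdelic (weylLongU (c : E →+* E) (rfl : (StdForm.antidiagonal 2).over E = (StdForm.antidiagonal 2).over E)) * (v : (quasiSplit F E c 2).Adelic)) : ℝ) ^ z.re ∂ν) *
          ENNReal.ofReal ((borelHeight g : ℝ) ^ (1 - z.re)) := by
  have hCφ : 0 ≤ Cφ := (norm_nonneg _).trans (hφC 1)
  have hc0 : 0 ≤ ∫ v : ↥(adelicUnipotent F E c 2), (borelHeight ((quasiSplit F E c 2).toAdelic (weylLongU (c : E →+* E) (rfl : (StdForm.antidiagonal 2).over E = (StdForm.antidiagonal 2).over E)) * (v : (quasiSplit F E c 2).Adelic)) : ℝ) ^ z.re ∂ν :=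
    integral_nonneg fun v => Real.rpow_nonneg (NNReal.coe_nonneg _) _
  have hI := integrable_borelHeight_weylLongU_mul_rpow ν h𝓕N z g hfin
  -- `w₀⁻¹ = w₀`
  have hW : ((quasiSplit F E c 2).toAdelic (weylLongU (c : E →+* E) (rfl : (StdForm.antidiagonal 2).over E = (StdForm.antidiagonal 2).over E)))⁻¹ =
      (quasiSplit F E c 2).toAdelic (weylLongU (c : E →+* E) (rfl : (StdForm.antidiagonal 2).over E = (StdForm.antidiagonal 2).over E)) := by
    rw [← map_inv]
    exact congrArg _ (inv_eq_of_mul_eq_one_right (weylLongU_mul_weylLongU_two (c : E →+* E)))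
  -- on `{H(g) > T}` every `w₀ u g` is low: `ψ(w₀ u g) = f_z(w₀ u g)`, `|f_z| ≤ C_φ H^{Re z}`
  have hpt : ∀ u : ↥(adelicUnipotent F E c 2), ‖{y : (quasiSplit F E c 2).Adelic | borelHeight y ≤ T}.indicator (flatSectionU φ z) (((quasiSplit F E c 2).toAdelic (weylLongU (c : E →+* E) (rfl : (StdForm.antidiagonal 2).over E = (StdForm.antidiagonal 2).over E)))⁻¹ * ((u : (quasiSplit F E c 2).Adelic) * g)) - {y : (quasiSplit F E c 2).Adelic | T < borelHeight y}.indicator (flatSectionU αt (1 - z)) (((quasiSplit F E c 2).toAdelic (weylLongU (c : E →+* E) (rfl : (StdForm.antidiagonal 2).over E = (StdForm.antidiagonal 2).over E)))⁻¹ * ((u : (quasiSplit F E c 2).Adelic) * g))‖ₑ ≤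
      ENNReal.ofReal Cφ * ENNReal.ofReal ((borelHeight ((quasiSplit F E c 2).toAdelic (weylLongU (c : E →+* E) (rfl : (StdForm.antidiagonal 2).over E = (StdForm.antidiagonal 2).over E)) * ((u : (quasiSplit F E c 2).Adelic) * g)) : ℝ) ^ z.re) := by
    intro u
    have hnot := not_lt_borelHeight_weylLongU_unipotent_mul u.2 hT hg
    rw [mul_assoc] at hnot
    have hp : (0 : ℝ) < (borelHeight ((quasiSplit F E c 2).toAdelic (weylLongU (c : E →+* E) (rfl : (StdForm.antidiagonal 2).over E = (StdForm.antidiagonal 2).over E)) * ((u : (quasiSplit F E c 2).Adelic) * g)) : ℝ) := by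
      exact_mod_cast borelHeight_pos _
    rw [hW, indicator_of_mem (show (quasiSplit F E c 2).toAdelic (weylLongU (c : E →+* E) (rfl : (StdForm.antidiagonal 2).over E = (StdForm.antidiagonal 2).over E)) * ((u : (quasiSplit F E c 2).Adelic) * g) ∈ {y : (quasiSplit F E c 2).Adelic | borelHeight y ≤ T} from not_lt.1 hnot),
      indicator_of_notMem (show (quasiSplit F E c 2).toAdelic (weylLongU (c : E →+* E) (rfl : (StdForm.antidiagonal 2).over E = (StdForm.antidiagonal 2).over E)) * ((u : (quasiSplit F E c 2).Adelic) * g) ∉ {y : (quasiSplit F E c 2).Adelic | T < borelHeight y} from hnot),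
      sub_zero, ← ofReal_norm, flatSectionU_apply, norm_mul, Complex.norm_cpow_eq_rpow_re_of_pos hp, ← ENNReal.ofReal_mul hCφ]
    exact ENNReal.ofReal_le_ofReal (mul_le_mul_of_nonneg_right (hφC _) (Real.rpow_nonneg hp.le _))
  refine (lintegral_mono hpt).trans (le_of_eq ?_)
  rw [lintegral_const_mul' _ _ ENNReal.ofReal_ne_top, ← ofReal_integral_eq_lintegral_ofReal hI (Eventually.of_forall fun u => Real.rpow_nonneg (NNReal.coe_nonneg _) _),
    integral_borelHeight_weylLongU_mul_rpow_eq hc hc1 ν hBK z.re g, ENNReal.ofReal_mul hc0, mul_assoc]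

end Pointwise

end Summit.HodgeConjecture.HodgeConjecture.Cruxes.H413.K2E1MaassSelbergCMTwoPairings

end
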